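import Mathlib
import Summits.ResolutionOfSingularities.ResolutionOfSingularities.Theorems.WildQuotientsWildQuotientResolutionS1aInducedTorusOfRegular
import Summits.ResolutionOfSingularities.ResolutionOfSingularities.Theorems.WildQuotientsWildQuotientResolutionS1aInducedTorusRegular
import Summits.ResolutionOfSingularities.ResolutionOfSingularities.Theorems.WildQuotientsWildQuotientResolutionS1aInducedTorusLaurent

/-!
# (S1) The induced torus — `S1.TameToBR.InducedTorusStatement` PROVED
(crux stmt-ResolutionOfSingularities-17941 `WildQuotients.CyclicQuotientFourfolds`, line B `s1a-tamebr`, stub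
`stub_tameToBR` sub-structure (S1) of `…S1aTameToBR` (p563790); plan-1 ASSIGN 2026-08-27T19:48:55Z. [OURS · L1 W4.5c]
— NOT statements of the manuscript; counted 0. Owner res-L1-w45c-stub-4 (gen 5).)

Assembly of the induced-torus files: `…S1aInducedTorusRing` (the ring `R = ⊕_λ 𝒜(λ mod r)` and its tautological
`ℤᵐ`-grading), `…Units` (homogeneous units in all degrees `e • χ`, `e = [D^ : ⟨s⟩]`; `R₀ ≃ₐ[k] 𝒜 0`), `…FiniteType`,
`…Regular` (faithfully flat descent from `B[ℤᵐ]`, modulo `LaurentRegular`), `…Laurent` (`B[ℤᵐ]` regular),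
`…OfRegular` (the statement from `InducedRingRegular`; smoothness = regular + finite type over a perfect field).
* `InducedTorus.laurentRegular_holds : LaurentRegular`;
* `InducedTorus.inducedRingRegular_holds : InducedRingRegular`;
* **`S1.TameToBR.inducedTorus_holds : S1.TameToBR.InducedTorusStatement`** — (S1) of the intended proof of
  `TameBRExitCover` (the content of `stub_tameToBR`), unconditionally.
-/

set_option linter.dupNamespace false

noncomputable section

namespace Summit.ResolutionOfSingularities.ResolutionOfSingularities.Theorems.WildQuotientResolution.S1

namespace InducedTorus

/-- **«Laurent is regular» holds**: `B` regular ⟹ `B[ℤᵐ]` regular. [OURS · L1 W4.5c] -/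
theorem laurentRegular_holds : LaurentRegular := fun B _ m hB => by
  haveI := hB
  exact isRegularRing_laurent B m

/-- **The induced-torus ring of a regular graded algebra is regular** (unconditionally). [OURS · L1 W4.5c] -/
theorem inducedRingRegular_holds : InducedRingRegular := fun _k _ _m r _B _ _ _ 𝒜 _ hB =>
  isRegularRing_of_laurentRegular r 𝒜 laurentRegular_holds hB

/-- The induced-torus ring is regular (instance-style corollary). [OURS · L1 W4.5c] -/
theorem isRegularRing_inducedRing {m : ℕ} (r : Fin m → ℕ) {k : Type} [Field k] {B : Type} [CommRing B]
    [Algebra k B] (𝒜 : (Π j : Fin m, ZMod (r j)) → Submodule k B) [GradedAlgebra 𝒜] [IsRegularRing B] :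
    IsRegularRing (InducedRing r 𝒜) :=
  isRegularRing_of_laurentRegular r 𝒜 laurentRegular_holds inferInstance

end InducedTorus

namespace TameToBR

/-- **(S1) THE INDUCED TORUS, PROVED**: a tame root chart `B = ⊕_{d ∈ Π ZMod (r j)} 𝒜 d`, regular and of finite type
over a perfect field `k`, with homogeneous units in the degrees of a finite-index set `s`, is the degree-`0` part of
the smooth finite-type `ℤᵐ`-graded `k`-algebra `R = ⊕_λ 𝒜(λ mod r)` with homogeneous units in all degrees `e • χ`,
`e = [Π ZMod (r j) : ⟨s⟩] ≥ 1` — the input format of `exists_slice`. [OURS · L1 W4.5c] -/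
theorem inducedTorus_holds : InducedTorusStatement :=
  InducedTorus.inducedTorus_of_regular InducedTorus.inducedRingRegular_holds

end TameToBR

end Summit.ResolutionOfSingularities.ResolutionOfSingularities.Theorems.WildQuotientResolution.S1

end
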